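import Summits.BirchSwinnertonDyer.BirchSwinnertonDyer.Theorems.ManinLocalTwoThreeBracketSturmOneSixtyB
import HarnessLib

/-!
# Level 160 = 2⁵·5 (C2 domain, `32 ∥ 160` — additive wild at 2 with conductor exponent 5; TWO classes `160a`, `160b = 160a ⊗ χ₋₄`) COMPLETE:
# `|c| = 1` — hence `2 ∤ c` — for EVERY lattice-optimal `X₀(160)`-datum of EVERY globally minimal elliptic curve over `ℚ`, UNCONDITIONALLY

Cell `bsd-f2-manin`, route `ManinLocalTwoThree`, crux C2 `ManinOddAtFour` (stmt-BirchSwinnertonDyer-22967: `2² ∣ 160`); prover seat p2 gen 31; `--supports`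
(helper).  ASSEMBLY: an g55's FACT-FREE two-row kernel pinning `PinningOneSixty.pinning` (rows `160a`: `d′ = 10`, `160b`: `d′ = 150`, on the
`32`-quotient `η`-basis of `M₂(Γ₀(160))`; landed by LEAD p1 g26) + this seat's DEEP tables (`…EtaTablesOneSixtyDeep*`, depth `290 = μ₀ + 2`, STAGED dense
certificates with pentagonal Euler tables) + the two Bracket–Sturm certificates `…BracketSturmOneSixtyA/B` (`160a1 = [0,1,0,−6,4]`, `160b1 = [0,−1,0,−6,−4]`;
`(B, A)` by exact linear algebra, nullity found; one defect decide each; Sturm `288 < 290`): **`|c| = 1` and `2 ∤ c` on `X₀(160)`**.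
HONEST FRAMING: unconditional (standard axioms); ONE level of C2 — nothing here proves C2 for all `N`, Manin's conjecture or BSD; item 22967 stays OPEN.
[cite: Manin1972, Prop. 1.4] [cite: Sturm1987, Thm. 1] [cite: AgasheRibetStein2006, §§1–2] [cite: CremonaAlgorithms1997, §2.10, Table 1 (160a1, 160b1), Table 3 (N = 160)]
[cite: Koehler2011, §2.1]
-/

set_option autoImplicit false
-- lint-debt: the directory name repeats the summit name (sibling precedent `ManinLocalTwoThreeManinConstantEightyEight.lean`)
set_option linter.dupNamespace false

noncomputable section

open Complex
open UpperHalfPlane hiding I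
open scoped MatrixGroups ModularForm
open ModularForm CongruenceSubgroup PowerSeries
open Literature.NumberTheory.ModularForms
open Literature.NumberTheory.EllipticCurves Literature.NumberTheory.EllipticCurves.ModularForms

namespace Summit.BirchSwinnertonDyer.BirchSwinnertonDyer.Theorems.ManinLocalTwoThree.LevelOneSixty

open Summit.BirchSwinnertonDyer.BirchSwinnertonDyer.Theorems.ManinLocalTwoThree.BracketSturm Summit.BirchSwinnertonDyer.BirchSwinnertonDyer.Theorems.ManinLocalTwoThree.PinningKernel Summit.BirchSwinnertonDyer.BirchSwinnertonDyer.Theorems.ManinLocalTwoThree.PinningOneSixty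

/-- **`|c| = 1` FOR EVERY LATTICE-OPTIMAL `X₀(160)`-DATUM of every globally minimal elliptic curve over `ℚ`** — UNCONDITIONAL (both pinning rows).
[cite: Manin1972, Prop. 1.4] [cite: AgasheRibetStein2006, §§1–2] [cite: CremonaAlgorithms1997, Table 1 (160a1, 160b1)] -/
theorem abs_maninConstant_eq_one_oneSixty (W : WeierstrassCurve ℚ) [W.IsElliptic] [W.IsGloballyMinimal]
    (D : ModularParametrizationData W 160) (hopt : ∀ z ∈ D.L.lattice, ∃ w ∈ periodLattice D.f, z = D.c * w) :
    |D.maninConstant| = 1 := by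
  obtain ⟨C, hC, c, hc, -, hpin⟩ := pinning D
  rw [show goodCerts = [rowA, rowB] from rfl] at hc
  simp only [List.mem_cons, List.mem_nil_iff, or_false] at hc
  rcases hc with rfl | rfl
  · exact abs_maninConstant_eq_one_oneSixtyA_of_row W D hopt C hC hpin
  · exact abs_maninConstant_eq_one_oneSixtyB_of_row W D hopt C hC hpin

/-- **C2 `ManinOddAtFour` at `N = 160` (`2² ∣ 160`): `2 ∤ c(D)`** for every lattice-optimal `X₀(160)`-datum — UNCONDITIONAL. [cite: AgasheRibetStein2006, §§1–2] -/
theorem not_two_dvd_maninConstant_oneSixty (W : WeierstrassCurve ℚ) [W.IsElliptic] [W.IsGloballyMinimal]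
    (D : ModularParametrizationData W 160) (hopt : ∀ z ∈ D.L.lattice, ∃ w ∈ periodLattice D.f, z = D.c * w) :
    ¬ (2 : ℤ) ∣ D.maninConstant := by
  have h := abs_maninConstant_eq_one_oneSixty W D hopt
  intro h2
  have := Int.le_of_dvd (by rw [h]; norm_num) ((dvd_abs _ _).mpr h2)
  rw [h] at this
  norm_num at this

/-- **The C2 conclusion on the whole `X₀(160)`-domain**: `2² ∣ 160`, and `|c| = 1 ∧ 2 ∤ c` for every lattice-optimal `X₀(160)`-datum of every globally minimal
elliptic curve over `ℚ` — UNCONDITIONAL; BSD and C2 for general `N` are NOT proved by this. [folklore] -/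
theorem maninOddAtFour_oneSixty :
    2 ^ 2 ∣ 160 ∧ ∀ (W : WeierstrassCurve ℚ) [W.IsElliptic] [W.IsGloballyMinimal] (D : ModularParametrizationData W 160),
      (∀ z ∈ D.L.lattice, ∃ w ∈ periodLattice D.f, z = D.c * w) → |D.maninConstant| = 1 ∧ ¬ (2 : ℤ) ∣ D.maninConstant :=
  ⟨⟨40, by norm_num⟩, fun W _ _ D hopt ↦ ⟨abs_maninConstant_eq_one_oneSixty W D hopt, not_two_dvd_maninConstant_oneSixty W D hopt⟩⟩

end Summit.BirchSwinnertonDyer.BirchSwinnertonDyer.Theorems.ManinLocalTwoThree.LevelOneSixty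

end
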